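import Literature.MathematicalPhysics.QuantumLattice.KomaPiFluxKomaTasakiSystem
import Literature.MathematicalPhysics.QuantumLattice.KomaTasakiGriffithsTheorem
import Literature.MathematicalPhysics.QuantumLattice.InfVolFermionStateGaugeCommutator
import HarnessLib

/-!
# Koma's `π`-flux BCS lattice-fermion model IS a Koma–Tasaki `ℤ₂` system (KT93 §2) — the
# positive-temperature instance: free energy, sourced order parameter and symmetric moments of
# `H(κ,U;g,g') - B·O` on the torus `(ℤ/Lℤ)^{d+1}` in the vocabulary of `kt93_theorem_2_1`

T. Koma, *Nambu–Goldstone modes for superconducting lattice fermions*, arXiv:2201.13135 (2022) [Koma2022],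
§2 (2.4)–(2.11): the Hamiltonian `H^{(Λ)}(B) = H_hop + H_int - B O^{(Λ)}` with the symmetry-breaking field
`B` coupled to the superconducting order parameter `O^{(Λ)}` (2.5), the thermal expectation
`⟨⋯⟩^{(Λ)}_{β,B}` (2.10) and the long-range order parameter `m^{(Λ)}_LRO = |Λ|⁻¹ √⟨[O^{(Λ)}]²⟩_{β,0}`
(2.11).  T. Koma, H. Tasaki, Commun. Math. Phys. 158 (1993) 191 [KomaTasaki1993], §2: a `ℤ₂` system is
the data `H_Λ = Σ_x h_x` (2.2), `O_Λ = Σ_x o_x` (2.4), a unitary `U_Λ` with `U_Λ H_Λ U_Λ* = H_Λ` (2.3),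
`U_Λ O_Λ U_Λ* = -O_Λ` (2.5), and the volume-uniform hypotheses ii) `‖h_x‖ ≤ h̄`, `‖o_x‖ ≤ ō`, iii)
`[h_x, o_y] = 0` unless `y ∈ S(x)`, `|S(x)| ≤ r` — the tree's `KomaTasaki.Z2System`
(`KomaTasakiGriffithsTheorem.lean`), the input structure of KT93 Theorem 2.1 `kt93_theorem_2_1(_holds)`.

The companion file `KomaPiFluxKomaTasakiSystem.lean` made Koma's model (Lieb frame,
`KomaPiFlux.hamiltonianC κ U g g' 0 B` on `FermionTorus (d+1) L`) a KT94 `U1System` (the ground-state /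
`T = 0` structure).  This file supplies the KT93 (`T > 0`) structure with the SAME local data:

* **`KomaPiFlux.z2System κ U g g'`** `: KomaTasaki.Z2System |Λ| (hbarConst d κ U g g') 2 (2(d+1)+1) (Idx d L)`
  — sites enumerated by `Fintype.equivFin`, `h_x = KT.localHam κ U g g' x` (the terms of `H` anchored at `x`,
  `Σ_x h_x = hamiltonianC κ U g g' 0 0`), `o_x = Γ²_x` (`Σ_x o_x = orderParameter = Σ_xΓ²_x`, the operator
  sourced by `B`), `U_Λ = e^{i(π/2)N̂}` (the gauge quarter turn: `H` conserves the particle number,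
  `PairHopRP.commute_totalNumber_hamiltonianC_zero`, and `Γ²_x = i(Γ⁺_x - Γ⁻_x)` has components of charge
  `±2`, so `e^{i(π/2)N̂} Γ²_x e^{-i(π/2)N̂} = -Γ²_x`: `gaugeAut_pi_div_two_gammaTwo`), `S(x) = nbhd x`;
* dictionary (PROVED): `z2System_hamiltonian` (`H_Λ = hamiltonianC κ U g g' 0 0`), `z2System_order`
  (`O_Λ = orderParameter`), **`z2System_fieldHamiltonian`** (`H_Λ(B) = hamiltonianC κ U g g' 0 B`, Koma's
  (2.4) with the field, Lieb frame), `z2System_magnetisation` (`m_Λ(B) = |Λ|⁻¹ Re⟨Σ_xΓ²_x⟩_{β,B}`),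
  **`z2System_moment_one`** (`N⁻²⟨O_Λ²⟩_Λ(0) = lroSq β (hamiltonianC κ U g g' 0 0)` — the symmetric second
  moment IS the tree's long-range order parameter of Koma's Theorem 2.1, by the `η`-rotation symmetry
  `⟨Γ²_xΓ²_y⟩ = ⟨Γ¹_xΓ¹_y⟩`, `PairHopRP.gibbsState_gammaOne_mul_eq_coulomb`), `z2System_freeEnergy`;
* the dimension bound needed by the hypothesis-i)-free form of KT93 Theorem 2.1
  (`KomaTasakiGriffithsTheoremSubsequence.lean`): `log dim 𝓕(Λ) = 2|Λ| log 2 ≤ 2|Λ|`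
  (`log_card_idx_le`), and `|Λ_{2k}| → ∞` (`tendsto_card_fermionTorus_two_mul`).

Everything is PROVED; one definition with body (the instance).  Sibling-model file (Koma's `π`-flux BCS
model), NOT a statement about the Hubbard model.

## References

* [Koma2022] T. Koma, arXiv:2201.13135, §2 (2.4)–(2.11), §3 (3.1)–(3.3), (3.11), §8 (8.1)–(8.3).
* [KomaTasaki1993] T. Koma, H. Tasaki, Commun. Math. Phys. 158 (1993) 191–214, §2 (2.1)–(2.12), ii), iii).
* [KomaTasaki1994] T. Koma, H. Tasaki, J. Stat. Phys. 76 (1994) 745–803, §3.3–3.4 (lattice-electron data).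
* [BratteliRobinsonII1997] O. Bratteli, D. W. Robinson, *OAQSM 2*, 2nd ed., §5.2.2 (gauge group of the CAR algebra).

## Design notes

`attribute [local instance] LiebCutRP.decEqTorus` as in every file of the `KomaPiFlux` series.  The `ℤ₂`
unitary is the tree's `fockGaugeU1 (π/2)` (`FockGaugeAction.lean`), exactly as in the Hubbard `d`-wave
instance `DWaveKomaTasakiThermal.dWaveZ2System`.
-/

noncomputable section

namespace Literature.MathematicalPhysics.QuantumLattice

open _root_.Matrix Finset Filter Topology HubbardWave0 PairHopRP FermionTorus LiebCutRP
open Literature.Probability.LatticeModels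
open scoped Matrix.Norms.L2Operator ComplexConjugate ComplexOrder

/-! ### Gauge charges of the `η`-pairing operators (generic lattice) -/

namespace PairHopRP

section Gauge

variable {Λ : Type*} [LinearOrder Λ] [Fintype Λ]

/-- `Γ⁺_x = c†_{x↑}c†_{x↓}` has gauge charge `+2`. [cite: BratteliRobinsonII1997, §5.2.2] [cite: Koma2022, (3.8)–(3.10)] -/
theorem hasGaugeCharge_gammaPlus (x : Λ) : HasGaugeCharge 2 (gammaPlus x) := by
  have h := (hasGaugeCharge_creation (orb x 0)).mul (hasGaugeCharge_creation (orb x 1))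
  norm_num at h
  exact h

/-- `Γ⁻_x = c_{x↓}c_{x↑}` has gauge charge `-2`. [cite: BratteliRobinsonII1997, §5.2.2] [cite: Koma2022, (3.8)–(3.10)] -/
theorem hasGaugeCharge_gammaMinus (x : Λ) : HasGaugeCharge (-2) (gammaMinus x) :=
  hasGaugeCharge_annihilation_mul_annihilation _ _

/-- **The gauge quarter turn flips `Γ²_x`**: `γ_{π/2}(Γ²_x) = -Γ²_x` (`e^{±iπ} = -1` on the charge-`±2`
components) — KT93's sign-flipping unitary (2.5) for the superconducting order parameter.
[cite: KomaTasaki1993, §2 (2.5)] [cite: Koma2022, (3.3), (3.8)–(3.10)] -/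
theorem gaugeAut_pi_div_two_gammaTwo (x : Λ) : gaugeAut (Real.pi / 2) (gammaTwo x) = -gammaTwo x := by
  rw [gammaTwo, map_smul, map_sub, hasGaugeCharge_gammaPlus x (Real.pi / 2),
    hasGaugeCharge_gammaMinus x (Real.pi / 2)]
  have h1 : Complex.exp (Complex.I * ((Real.pi / 2 : ℝ) : ℂ) * ((2 : ℤ) : ℂ)) = -1 := by
    rw [show Complex.I * ((Real.pi / 2 : ℝ) : ℂ) * ((2 : ℤ) : ℂ) = Real.pi * Complex.I by push_cast; ring,
      Complex.exp_pi_mul_I]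
  have h2 : Complex.exp (Complex.I * ((Real.pi / 2 : ℝ) : ℂ) * ((-2 : ℤ) : ℂ)) = -1 := by
    rw [show Complex.I * ((Real.pi / 2 : ℝ) : ℂ) * ((-2 : ℤ) : ℂ) = -(Real.pi * Complex.I) by push_cast; ring,
      Complex.exp_neg, Complex.exp_pi_mul_I]
    norm_num
  rw [h1, h2, neg_one_smul, neg_one_smul, smul_sub, smul_sub, smul_neg, smul_neg]
  abel

/-- `γ_{π/2}(Σ_xΓ²_x) = -Σ_xΓ²_x`. [cite: KomaTasaki1993, §2 (2.5)] -/
theorem gaugeAut_pi_div_two_orderParameter :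
    gaugeAut (Real.pi / 2) (orderParameter : Matrix (Finset (Orb Λ)) (Finset (Orb Λ)) ℂ) = -orderParameter := by
  rw [orderParameter, map_sum, ← Finset.sum_neg_distrib]
  exact Finset.sum_congr rfl fun x _ => gaugeAut_pi_div_two_gammaTwo x

variable (G : SimpleGraph Λ) [DecidableRel G.Adj]

/-- **`H(T,U;g,g';0;0)` is gauge invariant**: `γ_θ(H) = H` for every `θ` (it conserves the particle
number). [cite: KomaTasaki1994, (2.12), §3.3] [cite: BratteliRobinsonII1997, §5.2.2] -/
theorem gaugeAut_hamiltonianC_zero (T : Fin 2 → Λ → Λ → ℂ) (U g g' : ℝ) (θ : ℝ) :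
    gaugeAut θ (hamiltonianC G T U g g' (fun _ _ => 0) 0) = hamiltonianC G T U g g' (fun _ _ => 0) 0 := by
  refine forall_gaugeAut_eq_iff_commute.2 ?_ θ
  rw [totalNumberOp_eq_totalNumber]
  exact commute_totalNumber_hamiltonianC_zero G T U g g'

end Gauge

end PairHopRP

namespace KomaPiFlux

attribute [local instance] LiebCutRP.decEqTorus

variable {d L : ℕ} [NeZero L]

open KT

/-! ### The instance -/

/-- **Koma's `π`-flux BCS model (Lieb frame, torus `(ℤ/Lℤ)^{d+1}`) as a Koma–Tasaki `ℤ₂` system** (KT93 §2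
(2.1)–(2.5), ii), iii)): `N = |Λ|` sites (enumerated by `Fintype.equivFin`), `h_x = localHam κ U g g' x`
(`Σ_x h_x = H(κ,U;g,g';0;0)`), `o_x = Γ²_x` (`Σ_x o_x = O = Σ_xΓ²_x`), `U_Λ = e^{i(π/2)N̂}` ((2.3) by
particle-number conservation, (2.5) since `Γ²` has charge components `±2`), `S(x) = nbhd x`
(`r = 2(d+1)+1`), `h̄ = hbarConst d κ U g g'`, `ō = 2`.
[cite: KomaTasaki1993, §2 (2.1)–(2.9), ii), iii)] [cite: Koma2022, (2.4)–(2.6), (3.3)] [cite: KomaTasaki1994, §3.3–3.4] -/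
def z2System (κ U g g' : ℝ) :
    KomaTasaki.Z2System (Fintype.card (FermionTorus (d + 1) L)) (hbarConst d κ U g g') 2 (2 * (d + 1) + 1)
      (Idx d L) where
  h i := localHam κ U g g' ((Fintype.equivFin (FermionTorus (d + 1) L)).symm i)
  o i := gammaTwo ((Fintype.equivFin (FermionTorus (d + 1) L)).symm i)
  U := fockGaugeU1 (Real.pi / 2)
  supp i := (nbhd ((Fintype.equivFin (FermionTorus (d + 1) L)).symm i)).map
    (Fintype.equivFin (FermionTorus (d + 1) L)).toEmbedding
  isHermitian_h i := isHermitian_localHam κ U g g' _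
  isHermitian_o i := gammaTwo_isHermitian _
  U_mul_conjTranspose := fockGaugeU1_mul_conjTranspose_self _
  conj_hamiltonian := by
    rw [(Fintype.equivFin (FermionTorus (d + 1) L)).symm.sum_comp (fun y => localHam κ U g g' y), sum_localHam,
      ← gaugeAut_apply, KomaPiFlux.hamiltonianC, PairHopRP.gaugeAut_hamiltonianC_zero]
  conj_order := by
    rw [(Fintype.equivFin (FermionTorus (d + 1) L)).symm.sum_comp (fun y => gammaTwo y), ← gaugeAut_apply,
      ← PairHopRP.orderParameter, PairHopRP.gaugeAut_pi_div_two_orderParameter]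
  norm_h_le i := norm_localHam_le κ U g g' _
  norm_o_le i := norm_gammaTwo_le _
  commute_h_o i j hj := by
    have hj' : (Fintype.equivFin (FermionTorus (d + 1) L)).symm j ∉
        nbhd ((Fintype.equivFin (FermionTorus (d + 1) L)).symm i) := by
      rwa [Finset.mem_map_equiv] at hj
    exact commute_of_mem_carEvenSubalgebra (localHam_mem κ U g g' _)
      ((carEvenSubalgebra_le_carSubalgebra _) (gammaTwo_mem (Finset.mem_singleton_self _)))
      (disjoint_orbSet (disjoint_nbhd_singleton hj'))
  card_supp_le i := by
    rw [Finset.card_map]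
    exact KT.card_nbhd_le _
  two_le_r := by omega

/-! ### Dictionary -/

section Dictionary

variable (κ U g g' : ℝ)

/-- `H_Λ = H(κ,U;g,g';0;0)` (`hamiltonianC κ U g g' 0 0`). [cite: KomaTasaki1993, §2 (2.2)] [cite: Koma2022, (2.4), (8.3)] -/
theorem z2System_hamiltonian :
    (z2System (d := d) (L := L) κ U g g').hamiltonian =
      hamiltonianC κ U g g' (fun (_ _ : FermionTorus (d + 1) L) => (0 : ℝ)) 0 := by
  rw [KomaTasaki.Z2System.hamiltonian]
  change ∑ i, localHam κ U g g' ((Fintype.equivFin (FermionTorus (d + 1) L)).symm i) = _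
  rw [(Fintype.equivFin (FermionTorus (d + 1) L)).symm.sum_comp (fun y => localHam κ U g g' y), sum_localHam]

/-- `O_Λ = Σ_xΓ²_x = orderParameter`. [cite: KomaTasaki1993, §2 (2.4)] [cite: Koma2022, (2.5), (5.59)] -/
theorem z2System_order :
    (z2System (d := d) (L := L) κ U g g').order = (orderParameter : Matrix (Idx d L) (Idx d L) ℂ) := by
  rw [KomaTasaki.Z2System.order]
  change ∑ i, gammaTwo ((Fintype.equivFin (FermionTorus (d + 1) L)).symm i) = _
  rw [(Fintype.equivFin (FermionTorus (d + 1) L)).symm.sum_comp (fun y => gammaTwo y), orderParameter]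

/-- **`H_Λ(B) = H(κ,U;g,g';0;B)`**: the KT93 field Hamiltonian (2.6) of the instance is Koma's sourced
Hamiltonian (2.4) (Lieb frame). [cite: KomaTasaki1993, §2 (2.6)] [cite: Koma2022, (2.4), (3.6)] -/
theorem z2System_fieldHamiltonian (B : ℝ) :
    (z2System (d := d) (L := L) κ U g g').fieldHamiltonian B =
      hamiltonianC κ U g g' (fun (_ _ : FermionTorus (d + 1) L) => (0 : ℝ)) B := by
  rw [KomaTasaki.Z2System.fieldHamiltonian, z2System_hamiltonian, z2System_order, hamiltonianC_source κ U g g' B]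

/-- The sourced order parameter per site of the instance is Koma's: `m_Λ(B) = |Λ|⁻¹ Re⟨Σ_xΓ²_x⟩_{β, H(B)}`.
[cite: KomaTasaki1993, §2 (2.9), (2.11)] [cite: Koma2022, (2.10)] -/
theorem z2System_magnetisation (β B : ℝ) :
    (z2System (d := d) (L := L) κ U g g').magnetisation β B =
      (Fintype.card (FermionTorus (d + 1) L) : ℝ)⁻¹ *
        (gibbsState β (hamiltonianC κ U g g' (fun (_ _ : FermionTorus (d + 1) L) => (0 : ℝ)) B)
          orderParameter).re := by
  rw [KomaTasaki.Z2System.magnetisation, z2System_fieldHamiltonian, z2System_order]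

/-- The free energy per site of the instance is Koma's: `f_Λ(B) = -(β|Λ|)⁻¹ log Tr e^{-βH(B)}` ((2.7)–(2.8) of
KT93 with `Z^{(Λ)}_{β,B}` of Koma (2.10)). [cite: KomaTasaki1993, §2 (2.7)–(2.8)] [cite: Koma2022, (2.10)] -/
theorem z2System_freeEnergy (β B : ℝ) :
    (z2System (d := d) (L := L) κ U g g').freeEnergy β B =
      -(β * Fintype.card (FermionTorus (d + 1) L))⁻¹ *
        Real.log (partitionFn β (hamiltonianC κ U g g' (fun (_ _ : FermionTorus (d + 1) L) => (0 : ℝ)) B)).re := by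
  rw [KomaTasaki.Z2System.freeEnergy, z2System_fieldHamiltonian]

/-- **The symmetric second moment IS the long-range order parameter of Koma's Theorem 2.1**:
`N⁻²⟨O_Λ²⟩_Λ(0) = lroSq β H(κ,U;g,g';0;0)` (`= |Λ|⁻² Σ_{x,y} Re⟨Γ¹_xΓ¹_y⟩_β`; `⟨Γ²_xΓ²_y⟩ = ⟨Γ¹_xΓ¹_y⟩` by the
`η`-rotation symmetry). [cite: KomaTasaki1993, §2 (2.12)] [cite: Koma2022, (2.11), (3.11), (6.18)–(6.19)] -/
theorem z2System_moment_one (β : ℝ) :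
    (z2System (d := d) (L := L) κ U g g').moment β 1 =
      lroSq β (hamiltonianC κ U g g' (fun (_ _ : FermionTorus (d + 1) L) => (0 : ℝ)) 0) := by
  rw [KomaTasaki.Z2System.moment, z2System_hamiltonian, z2System_order, lroSq, mul_one, pow_two, pow_two,
    orderParameter, Finset.sum_mul_sum, map_sum, Complex.re_sum, div_eq_inv_mul]
  congr 1
  refine Finset.sum_congr rfl fun x _ => ?_
  rw [map_sum, Complex.re_sum]
  refine Finset.sum_congr rfl fun y _ => ?_
  rw [pairCorr, KomaPiFlux.hamiltonianC, PairHopRP.gibbsState_gammaOne_mul_eq_coulomb]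

end Dictionary

/-! ### Volume bookkeeping for the hypothesis-i)-free form of KT93 Theorem 2.1 -/

omit [NeZero L] in
/-- `dim 𝓕(Λ) = 2^{2|Λ|}` (the fermionic Fock space over `|Λ|` sites with spin). [cite: KomaTasaki1994, §3.3] -/
theorem card_idx : Fintype.card (Idx d L) = 2 ^ (2 * Fintype.card (FermionTorus (d + 1) L)) := by
  rw [Fintype.card_finset, card_orb]

omit [NeZero L] in
/-- **`log dim 𝓕(Λ) ≤ 2|Λ|`** (`log dim = 2|Λ| log 2`): the dimension hypothesis of
`KomaTasaki.Z2System.exists_strictMono_forall_tendsto_freeEnergy` for lattice fermions. [cite: KomaTasaki1994, §3.3] -/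
theorem log_card_idx_le :
    Real.log (Fintype.card (Idx d L)) ≤ 2 * (Fintype.card (FermionTorus (d + 1) L) : ℝ) := by
  rw [card_idx, Nat.cast_pow, Real.log_pow, Nat.cast_mul, Nat.cast_two]
  have hlog2 : Real.log 2 ≤ 1 := by
    have := Real.log_two_lt_d9; linarith
  have hN : (0 : ℝ) ≤ 2 * (Fintype.card (FermionTorus (d + 1) L) : ℝ) := by positivity
  calc 2 * (Fintype.card (FermionTorus (d + 1) L) : ℝ) * Real.log (2 : ℕ)
      = 2 * (Fintype.card (FermionTorus (d + 1) L) : ℝ) * Real.log 2 := by norm_num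
    _ ≤ 2 * (Fintype.card (FermionTorus (d + 1) L) : ℝ) * 1 := mul_le_mul_of_nonneg_left hlog2 hN
    _ = _ := mul_one _

omit [NeZero L] in
/-- `|Λ_L| = L^{d+1} → ∞` along `L → ∞`. [cite: KomaTasaki1993, §2 (van Hove sequences have |Λ| → ∞)] -/
theorem tendsto_card_fermionTorus :
    Tendsto (fun L : ℕ => Fintype.card (FermionTorus (d + 1) L)) atTop atTop := by
  have h : (fun L : ℕ => Fintype.card (FermionTorus (d + 1) L)) = fun L => L ^ (d + 1) := by
    funext L
    simp only [FermionTorus, Fintype.card_lex, Fintype.card_fun, Fintype.card_fin]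
  rw [h]
  exact tendsto_pow_atTop (by omega)

omit [NeZero L] in
/-- `|Λ_{2k}| → ∞` along the even tori `k → ∞`. [cite: Koma2022, (2.1), (2.12)] -/
theorem tendsto_card_fermionTorus_two_mul :
    Tendsto (fun k : ℕ => Fintype.card (FermionTorus (d + 1) (2 * k))) atTop atTop :=
  tendsto_card_fermionTorus.comp (tendsto_id.const_mul_atTop' (by norm_num : 0 < 2))

end KomaPiFlux

end Literature.MathematicalPhysics.QuantumLattice
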